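import Summits.CriticalPhenomena.Ising3DConformalLimit.Theses.CoerciveSharpness
import Literature.Probability.LatticeModels.SharpnessProofs
import HarnessLib

/-!
# Sketch — crux ideas for `CoerciveSharpness.PhiCoercive` (stmt-CriticalPhenomena-18196), ideator k = 2, round 1

First-lemma signatures (statements only, as `def … : Prop`) for the two idea cards

* `surface-creation-superharmonicity` (boundary half / `BoxCoercive`), §1;
* `hole-capacity-chain-rule` (superset half / `SupersetStable`), §2.

Everything is stated over existing declarations (`isingTwoPoint`, `isingExpect`, `spinAt`, `zdGraph`,
`box`, `criticalBeta`, `Site.supNorm`).  Nothing here is proved; the file must only elaborate.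
-/

noncomputable section

namespace Summit.CriticalPhenomena.Ising3DConformalLimit.Cruxes.PhiCoercive.IdeasK2

open scoped BigOperators
open Finset Literature.Probability.LatticeModels

/-! ## §0 Vocabulary -/

/-- `u_S(a,x) = ⟨σ_a σ_x⟩^free_{S, β_c(3)}`. -/
def uC (S : Finset (Site 3)) (a x : Site 3) : ℝ :=
  isingTwoPoint (zdGraph 3) S (criticalBeta 3) 0 .free a x

/-- neighbours of `x` inside `S`. -/
def nbrsIn (S : Finset (Site 3)) (x : Site 3) : Finset (Site 3) :=
  ((zdGraph 3).neighborFinset x).filter fun y => y ∈ S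

/-- number of neighbours of `x` outside `S` (the weight `n_x(S)` in `φ`). -/
def nOut (S : Finset (Site 3)) (x : Site 3) : ℕ :=
  (((zdGraph 3).neighborFinset x).filter fun y => y ∉ S).card

/-- `φ_a(S) = β_c Σ_{x ∈ S} n_x(S) ⟨σ_a σ_x⟩_S` — the DC–Panis flux of `S` from the base point `a`
(`φ_0 = phiC` of the registered line, definitionally). -/
def phiFrom (a : Site 3) (S : Finset (Site 3)) : ℝ :=
  criticalBeta 3 * ∑ x ∈ S, (nOut S x : ℝ) * uC S a x

/-- The base point `0` gives back the route text of `PhiCoercive` verbatim (= the line's `phiC S`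
= `dcpPhi 3 (criticalBeta 3) S`, all by `rfl`). -/
example (S : Finset (Site 3)) :
    phiFrom 0 S = criticalBeta 3 * ∑ x ∈ S,
      ((((zdGraph 3).neighborFinset x).filter fun y => y ∉ S).card : ℝ) *
        isingTwoPoint (zdGraph 3) S (criticalBeta 3) 0 .free 0 x := rfl

/-- … and the crux unfolds over `phiFrom 0`. -/
example : Summit.CriticalPhenomena.Ising3DConformalLimit.Theses.CoerciveSharpness.PhiCoercive ↔
    ∃ κ c : ℝ, 0 < κ ∧ 0 < c ∧ ∀ m : ℕ, 1 ≤ m → ∀ S : Finset (Site 3), box 3 m ⊆ S →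
      c * (m : ℝ) ^ κ ≤ phiFrom 0 S := Iff.rfl

/-- depth of `x` below the surface of `Λ_m` (junk `0` outside). -/
def boxDepth (m : ℕ) (x : Site 3) : ℕ := m + 1 - Site.supNorm x

/-- local field at `x` produced by the neighbours inside `S`. -/
def localField (S : Finset (Site 3)) (x : Site 3) (σ : SpinConfig (Site 3)) : ℝ :=
  ∑ y ∈ nbrsIn S x, spinAt y σ

/-! ## §1 Card `surface-creation-superharmonicity` -/

/-- **L1a (free heat-bath / Schwinger–Dyson identity).**  For `x ∈ S`, `x ≠ 0`:
`⟨σ₀σ_x⟩_S = ⟨σ₀ · tanh(β_c · Σ_{y∼x, y∈S} σ_y)⟩_S` (one-site DLR at zero field, free b.c.; the tree has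
the `.fixed η` version `isingExpect_spinAt_mul_eq_tanh`). -/
def FreeHeatBath : Prop :=
  ∀ (S : Finset (Site 3)) (x : Site 3), x ∈ S → x ≠ 0 → (0 : Site 3) ∈ S →
    uC S 0 x =
      isingExpect (zdGraph 3) S (criticalBeta 3) 0 .free
        (fun σ => spinAt 0 σ * Real.tanh (criticalBeta 3 * localField S x σ))

/-- **L1b (flux = creation identity, discrete Gauss).**  For finite `S ∋ 0`:
`Σ_{x∈S} n_x(S) u_S(x) = Σ_{x∈S} (6·u_S(x) − Σ_{y∼x, y∈S} u_S(y))`, i.e.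
`φ(S)/β_c = L(0) + Σ_{x≠0} (6 b(x) − 1)·w(x)` with `w(x) = Σ_{y∼x,y∈S} u_S(y)` and the EFFECTIVE COUPLING
`b(x) = u_S(x)/w(x) = ⟨σ₀ tanh(β_c h_x)⟩/⟨σ₀ h_x⟩`: flux is CREATED exactly where `b(x) > 1/6`. -/
def FluxCreationIdentity : Prop :=
  ∀ (S : Finset (Site 3)), (0 : Site 3) ∈ S →
    ∑ x ∈ S, (nOut S x : ℝ) * uC S 0 x = ∑ x ∈ S, (6 * uC S 0 x - ∑ y ∈ nbrsIn S x, uC S 0 y)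

/-- **L1c (low-coordination sites always create flux).**  If `x ∈ S ∖ {0}` has at most `4`
neighbours in `S` and the pair correlations among those neighbours are `≤ 1/3` (Lebowitz makes the
`σ₀`-weighted law of `h_x` a genuine average), then `u_S(x) ≥ (tanh(4β_c)/4) · Σ_{y∼x,y∈S} u_S(y)` with
`tanh(4β_c)/4 = 0.1774 > 1/6`: such `x` is a CREATION site.  (Corner/edge sites of a box, sites next to
holes of a superset.) -/
def LowCoordinationCreation : Prop :=
  ∀ (S : Finset (Site 3)) (x : Site 3), (0 : Site 3) ∈ S → x ∈ S → x ≠ 0 →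
    (nbrsIn S x).card ≤ 4 →
    (∀ y ∈ nbrsIn S x, ∀ y' ∈ nbrsIn S x, y ≠ y' →
        isingTwoPoint (zdGraph 3) S (criticalBeta 3) 0 .free y y' ≤ 1 / 3) →
    Real.tanh (4 * criticalBeta 3) / 4 * ∑ y ∈ nbrsIn S x, uC S 0 y ≤ uC S 0 x

/-- **L1d (first-layer superharmonicity on the faces of a box — the cheapest non-Gaussian fact).**
For a face site `x` of `Λ_m` (exactly `5` neighbours inside), `u(x) ≥ (1/6 + δ)·Σ_{y∼x,y∈Λ_m} u(y)` for a
universal `δ > 0`, GIVEN the numerical hypothesis that each pair correlation among the five neighbours is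
at most `0.247` (so the six pairs seen from any neighbour sum to `≤ 1.48`; Lebowitz + the exact expansion
`tanh(β_c h) = 0.18653 h − 0.013399 T₃ + 0.00476 T₅` on `h ∈ {±1,±3,±5}` then give `b(x) ≥ 0.1667 + δ`).
The hypothesis is stated, not assumed true. -/
def FirstLayerSuperharmonic : Prop :=
  ∃ δ : ℝ, 0 < δ ∧ ∀ (m : ℕ) (x : Site 3), 1 ≤ m → x ∈ box 3 m → x ≠ 0 →
    (nbrsIn (box 3 m) x).card = 5 →
    (∀ y ∈ nbrsIn (box 3 m) x, ∀ y' ∈ nbrsIn (box 3 m) x, y ≠ y' →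
        isingTwoPoint (zdGraph 3) (box 3 m) (criticalBeta 3) 0 .free y y' ≤ 0.247) →
    (1 / 6 + δ) * ∑ y ∈ nbrsIn (box 3 m) x, uC (box 3 m) 0 y ≤ uC (box 3 m) 0 x

/-- **ISQ — the conjectural sharp form (inverse-square / Hardy creation profile).**  Near the free surface
of `Λ_m` the effective coupling exceeds `1/6` by at least `c/depth²`:
`u(x) ≥ (1 + c/ℓ²)·(1/6)·Σ_{y∼x} u(y)` for `ℓ₀ ≤ ℓ = depth(x) ≤ ε m`.  An inverse-square creation profile
is exactly what turns the harmonic (Gaussian, `p = 1`) boundary decay `u ∝ depth` into `u ∝ depth^p`,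
`p(p−1) = −6c·(geometry)`, `p < 1` — the boundary gain `g = 1 − p` (physically `p = Δ̂_σ − Δ_σ ≈ 0.757`). -/
def InverseSquareCreation : Prop :=
  ∃ c ε : ℝ, 0 < c ∧ 0 < ε ∧ ∃ ℓ₀ : ℕ, 1 ≤ ℓ₀ ∧ ∀ (m : ℕ) (x : Site 3),
    x ∈ box 3 m → x ≠ 0 → ℓ₀ ≤ boxDepth m x → (boxDepth m x : ℝ) ≤ ε * m →
    (1 + c / (boxDepth m x : ℝ) ^ 2) * (1 / 6) * ∑ y ∈ nbrsIn (box 3 m) x, uC (box 3 m) 0 y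
      ≤ uC (box 3 m) 0 x

/-! ## §2 Card `hole-capacity-chain-rule` -/

/-- **L2a (hole-capacity bound, pointwise).**  For `0 ∈ S ⊆ Λ_R` and `x ∈ S`:
`u_S(0,x) ≥ u_R(0,x) − Σ_{h ∈ Λ_R ∖ S} u_R(0,h)·u_R(h,x)` — restricted switching
(`u_S/u_R = P[0 ↔ x in (n₁+n₂)|_S]`) + "the backbone avoids the holes" + the tree's chain rule for
backbone visits (`Current.tsum_backboneVisits_mul_le`). -/
def HoleCapacityPointwise : Prop :=
  ∀ (R : ℕ) (S : Finset (Site 3)), S ⊆ box 3 R → (0 : Site 3) ∈ S → ∀ x ∈ S,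
    uC (box 3 R) 0 x - ∑ h ∈ box 3 R \ S, uC (box 3 R) 0 h * uC (box 3 R) h x ≤ uC S 0 x

/-- **L2b (hole-capacity bound for the flux).**  Summing L2a over the outer boundary:
`φ(S) ≥ φ(Λ_R) − Σ_{h ∈ Λ_R ∖ S} u_R(0,h)·(φ_h(Λ_R) + 6β_c)` — a superset of `Λ_m` obtained from `Λ_R`
by deleting a hole set of small FLUX-WEIGHTED CAPACITY radiates at least half of `φ(Λ_R)`
(`SupersetStable` with `r := R`, `c' = 1/2`, in that regime). -/
def HoleCapacityFlux : Prop :=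
  ∀ (R : ℕ) (S : Finset (Site 3)), S ⊆ box 3 R → (0 : Site 3) ∈ S →
    phiFrom 0 (box 3 R)
        - ∑ h ∈ box 3 R \ S, uC (box 3 R) 0 h * (phiFrom h (box 3 R) + 6 * criticalBeta 3)
      ≤ phiFrom 0 S

/-- **BPS (base-point stability of box flux) — the regularity input that makes L2b bite for pinholes:**
the flux of `Λ_R` from any base point in the inner half-box is at most `C` times the flux from the
centre.  (Free-box sibling of the all-scale doubling / Harnack regularity of the critical two-point
function; open.) -/
def BasePointStability : Prop :=
  ∃ C : ℝ, 0 < C ∧ ∀ (R : ℕ), 1 ≤ R → ∀ y ∈ box 3 (R / 2), phiFrom y (box 3 R) ≤ C * phiFrom 0 (box 3 R)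

/-- The exposure inequality of the registered line (`phiC_ge_inner`), restated from a general base point:
the part of `φ(S)` through boundary edges that start in an inner set `T ⊆ S` is at least the same sum
computed with `T`'s own correlations. (GKS; proved for `a = 0` in `Lines/box_superset.lean`.) -/
def ExposureFrom : Prop :=
  ∀ (a : Site 3) (T S : Finset (Site 3)), T ⊆ S → a ∈ T →
    criticalBeta 3 * ∑ x ∈ T, (nOut S x : ℝ) * uC T a x ≤ phiFrom a S

end Summit.CriticalPhenomena.Ising3DConformalLimit.Cruxes.PhiCoercive.IdeasK2

end
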